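import Mathlib
import HarnessLib
import Summits.Ventures.LatticeQCDFlow.Exactness.ReplicaProductInvariant

/-!
# PTBC with heat-bath in-replica sweeps and any exact swap step converges to the product of the tempered Gibbs laws

HONEST FRAMING: exact (Metropolis-corrected) sampling algorithms for lattice gauge theory;
figures of merit are autocorrelation/cost numbers at stated couplings and volumes; no
continuum-physics claim.

Venture `LatticeQCDFlow` (cell pub-lqcd), topic `Exactness`, FANOUT row 9 (eng-latcore, the
engine `latflow.core.ptbc`: `R` replicas of the lattice, replica `r` updated by heat-bath (+
over-relaxation) sweeps for its own defect-weighted action — joint density `p r` — then swap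
proposals between neighbouring replicas and the translation of the periodic replica).  NEW WORK of
the cell over the tree (`HeatBathSweepErgodic.lean`: `siteHeatBath`, `heatBathSweep_minorised`,
`heatBathSweep_invariant_piGibbsLaw`, `piGibbsLaw`; `ReplicaProductDoeblin.lean` /
`ReplicaProductInvariant.lean`: the replica-product Doeblin skeleton).  Nothing here is cited as a
fact.  Printed counterparts, NAMED ONLY: Hasenbusch PRD 96 (2017) 054504; Bonanno–Bonati–D'Elia
JHEP 03 (2021) 111.

THE TYPED PTBC SKELETON.  One replica = the product `Π j : ι, X j` of probability spaces `(X j, μ j)`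
(links with Haar measure); replica `r : R` carries the measurable joint density `p r` pinched
`m ≤ p r ≤ M` uniformly in `r` (`0 < m`, `M < ∞`; the defect-weighted Wilson weights on a finite
ladder of couplings); its in-replica update is the heat-bath scan `cycle (l.map (siteHeatBath μ (p r)))`
over a list `l` through every site; the joint state is `R → (Π j, X j)`; one PTBC cycle is
`η ∘ₖ replicaSweep`, `η` ANY Markov move leaving the product of the tempered Gibbs laws
`⊗_r piGibbsLaw μ (p r)` invariant (the swap Metropolis steps and the translation: `PTBCSwap.lean`,
whose lift to the `R`-fold product is not written here).

* `ptbcInReplica μ p l r` (the in-replica heat-bath sweep of replica `r`), `ptbcTarget μ p`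
  (`⊗_r piGibbsLaw μ (p r)`); `ptbcInReplica_minorised` (`≥ (m/M)^{|l|} · ⊗μ` from every state,
  uniformly in `r`), `ptbcInReplica_invariant`;
* **`ptbc_heatBath_uniformlyErgodic`** — for every Markov `η` preserving `ptbcTarget μ p` and every
  scan `L` through all replicas: `|μ₀ Cᵗ(A) − ptbcTarget(A)| ≤ (1 − ((m/M)^{|l|})^{|L|})ᵗ` for every
  initial law `μ₀`, every `t`, every `A`, `C = η ∘ₖ replicaSweep (ptbcInReplica μ p l) L`;
  **`ptbcTarget_unique_invariant`** — `ptbcTarget μ p` is the ONLY probability law invariant under `C`;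
  **`ptbc_heatBathOR_uniformlyErgodic`** — the same bound with over-relaxation (any exact Markov
  kernel per replica) composed after each in-replica heat-bath scan.

NOT CLAIMED: the lift of the two-replica swap / translation to the product and its exactness for
`ptbcTarget` (hypothesis `hη`); swap acceptance or round-trip statistics; rates.
-/

noncomputable section

namespace Summit.Ventures.LatticeQCDFlow.Exactness

open MeasureTheory ProbabilityTheory Set Function
open scoped ENNReal

section PTBC

variable {R : Type*} {ι : Type*} [DecidableEq ι] {X : ι → Type*} [∀ j, MeasurableSpace (X j)]
variable (μ : ∀ j, Measure (X j)) [∀ j, IsProbabilityMeasure (μ j)] (p : R → (∀ j, X j) → ℝ≥0∞)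

/-- **The in-replica update of replica `r`**: the heat-bath scan over `l` for the density `p r`. -/
def ptbcInReplica (l : List ι) (r : R) : Kernel (∀ j, X j) (∀ j, X j) :=
  cycle (l.map (siteHeatBath μ (p r)))

variable [Fintype ι] [Fintype R]

omit [DecidableEq ι] in
/-- **The PTBC target**: the product over the replicas of the tempered Gibbs laws. -/
def ptbcTarget : Measure (R → ∀ j, X j) :=
  Measure.pi fun r => piGibbsLaw μ (p r)

variable {μ p} {m M : ℝ≥0∞} {l : List ι}

omit [Fintype ι] [Fintype R] in
/-- The in-replica sweeps are Markov (pinched densities). -/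
theorem isMarkovKernel_ptbcInReplica (hp : ∀ r, Measurable (p r)) (hm0 : m ≠ 0) (hMtop : M ≠ ∞)
    (hmp : ∀ r ω, m ≤ p r ω) (hpM : ∀ r ω, p r ω ≤ M) (r : R) : IsMarkovKernel (ptbcInReplica μ p l r) :=
  isMarkovKernel_heatBathSweep (μ := μ) (hp r) hm0 hMtop (hmp r) (hpM r) l

omit [DecidableEq ι] in
/-- The PTBC target is a probability law (pinched densities). -/
theorem isProbabilityMeasure_ptbcTarget (hm0 : m ≠ 0) (hMtop : M ≠ ∞) (hmp : ∀ r ω, m ≤ p r ω)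
    (hpM : ∀ r ω, p r ω ≤ M) : IsProbabilityMeasure (ptbcTarget μ p) := by
  haveI : ∀ r, IsProbabilityMeasure (piGibbsLaw μ (p r)) := fun r =>
    isProbabilityMeasure_piGibbsLaw (μ := μ) hm0 hMtop (hmp r) (hpM r)
  unfold ptbcTarget; infer_instance

omit [Fintype R] in
/-- **Each in-replica sweep is Doeblin**, with the same constant for every replica:
`(ptbcInReplica r)(ω, ·) ≥ (m/M)^{|l|} · ⊗μ` (`heatBathSweep_minorised`). -/
theorem ptbcInReplica_minorised (hp : ∀ r, Measurable (p r)) (hm0 : m ≠ 0) (hMtop : M ≠ ∞)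
    (hmp : ∀ r ω, m ≤ p r ω) (hpM : ∀ r ω, p r ω ≤ M) (hl : ∀ j, j ∈ l) (r : R) (ω : ∀ j, X j) :
    (m * M⁻¹) ^ l.length • Measure.pi μ ≤ ptbcInReplica μ p l r ω :=
  heatBathSweep_minorised (μ := μ) (hp r) hm0 hMtop (hmp r) (hpM r) hl ω

omit [Fintype R] in
/-- **Each in-replica sweep is exact** for its tempered Gibbs law. -/
theorem ptbcInReplica_invariant (hp : ∀ r, Measurable (p r)) (hm0 : m ≠ 0) (hMtop : M ≠ ∞)
    (hmp : ∀ r ω, m ≤ p r ω) (hpM : ∀ r ω, p r ω ≤ M) (r : R) :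
    Kernel.Invariant (ptbcInReplica μ p l r) (piGibbsLaw μ (p r)) :=
  heatBathSweep_invariant_piGibbsLaw (μ := μ) (hp r) hm0 hMtop (hmp r) (hpM r) l

variable [DecidableEq R]

/-- **PTBC WITH HEAT-BATH IN-REPLICA SWEEPS IS UNIFORMLY ERGODIC.**  Pinched measurable densities
`m ≤ p r ≤ M` (`0 < m`, `M < ∞`), a site scan `l` through every site, a replica scan `L` through every
replica, and ANY Markov move `η` on the replica product leaving `ptbcTarget μ p` invariant: with
`C = η ∘ₖ replicaSweep (ptbcInReplica μ p l) L`,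
`|μ₀ Cᵗ(A) − ptbcTarget(A)| ≤ (1 − ((m/M)^{|l|})^{|L|})ᵗ` for every initial law `μ₀`, every `t`, `A`. -/
theorem ptbc_heatBath_uniformlyErgodic (hp : ∀ r, Measurable (p r)) (hm0 : m ≠ 0) (hMtop : M ≠ ∞)
    (hmp : ∀ r ω, m ≤ p r ω) (hpM : ∀ r ω, p r ω ≤ M) (hl : ∀ j, j ∈ l) {L : List R} (hL : ∀ r, r ∈ L)
    (η : Kernel (R → ∀ j, X j) (R → ∀ j, X j)) [IsMarkovKernel η] (hη : Kernel.Invariant η (ptbcTarget μ p))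
    (μ₀ : Measure (R → ∀ j, X j)) [IsProbabilityMeasure μ₀] (t : ℕ) (A : Set (R → ∀ j, X j)) :
    |((fun ν : Measure (R → ∀ j, X j) => ν.bind (η ∘ₖ replicaSweep (ptbcInReplica μ p l) L))^[t] μ₀).real A
        - (ptbcTarget μ p).real A| ≤ (1 - (((m * M⁻¹) ^ l.length) ^ L.length).toReal) ^ t := by
  haveI := fun r => isMarkovKernel_ptbcInReplica (μ := μ) (l := l) hp hm0 hMtop hmp hpM r
  haveI : ∀ r, IsProbabilityMeasure (piGibbsLaw μ (p r)) := fun r =>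
    isProbabilityMeasure_piGibbsLaw (μ := μ) hm0 hMtop (hmp r) (hpM r)
  exact replicaCycle_convergesTo_pi (K := ptbcInReplica μ p l) (ν := fun _ : R => Measure.pi μ)
    (π := fun r => piGibbsLaw μ (p r)) (fun r x => ptbcInReplica_minorised hp hm0 hMtop hmp hpM hl r x)
    (fun r => ptbcInReplica_invariant hp hm0 hMtop hmp hpM r) hL η hη μ₀ t A

/-- **The product of the tempered Gibbs laws is the ONLY invariant probability law of the PTBC cycle.** -/
theorem ptbcTarget_unique_invariant (hp : ∀ r, Measurable (p r)) (hm0 : m ≠ 0) (hMtop : M ≠ ∞)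
    (hmp : ∀ r ω, m ≤ p r ω) (hpM : ∀ r ω, p r ω ≤ M) (hl : ∀ j, j ∈ l) {L : List R} (hL : ∀ r, r ∈ L)
    (η : Kernel (R → ∀ j, X j) (R → ∀ j, X j)) [IsMarkovKernel η] (hη : Kernel.Invariant η (ptbcTarget μ p))
    {P' : Measure (R → ∀ j, X j)} [IsProbabilityMeasure P']
    (hP' : Kernel.Invariant (η ∘ₖ replicaSweep (ptbcInReplica μ p l) L) P') : P' = ptbcTarget μ p := by
  haveI := fun r => isMarkovKernel_ptbcInReplica (μ := μ) (l := l) hp hm0 hMtop hmp hpM r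
  haveI : ∀ r, IsProbabilityMeasure (piGibbsLaw μ (p r)) := fun r =>
    isProbabilityMeasure_piGibbsLaw (μ := μ) hm0 hMtop (hmp r) (hpM r)
  have hε : 0 < (m * M⁻¹) ^ l.length :=
    pos_iff_ne_zero.2 (pow_ne_zero _ (mul_ne_zero hm0 (ENNReal.inv_ne_zero.2 hMtop)))
  exact pi_unique_invariant_replicaCycle (K := ptbcInReplica μ p l) (ν := fun _ : R => Measure.pi μ)
    (π := fun r => piGibbsLaw μ (p r)) (fun r x => ptbcInReplica_minorised hp hm0 hMtop hmp hpM hl r x)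
    hε (fun r => ptbcInReplica_invariant hp hm0 hMtop hmp hpM r) hL η hη hP'

/-- **THE SAME WITH OVER-RELAXATION INSIDE THE REPLICAS**: in-replica update `ηr r ∘ₖ` (heat-bath
scan), `ηr r` ANY Markov kernel on one replica leaving its tempered Gibbs law invariant (the engine's
over-relaxation sweeps, `WilsonOverrelaxation.lean`); the Doeblin constant is unchanged. -/
theorem ptbc_heatBathOR_uniformlyErgodic (hp : ∀ r, Measurable (p r)) (hm0 : m ≠ 0) (hMtop : M ≠ ∞)
    (hmp : ∀ r ω, m ≤ p r ω) (hpM : ∀ r ω, p r ω ≤ M) (hl : ∀ j, j ∈ l) {L : List R} (hL : ∀ r, r ∈ L)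
    (ηr : R → Kernel (∀ j, X j) (∀ j, X j)) [∀ r, IsMarkovKernel (ηr r)]
    (hηr : ∀ r, Kernel.Invariant (ηr r) (piGibbsLaw μ (p r)))
    (η : Kernel (R → ∀ j, X j) (R → ∀ j, X j)) [IsMarkovKernel η] (hη : Kernel.Invariant η (ptbcTarget μ p))
    (μ₀ : Measure (R → ∀ j, X j)) [IsProbabilityMeasure μ₀] (t : ℕ) (A : Set (R → ∀ j, X j)) :
    |((fun ν : Measure (R → ∀ j, X j) =>
          ν.bind (η ∘ₖ replicaSweep (fun r => ηr r ∘ₖ ptbcInReplica μ p l r) L))^[t] μ₀).real A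
        - (ptbcTarget μ p).real A| ≤ (1 - (((m * M⁻¹) ^ l.length) ^ L.length).toReal) ^ t := by
  haveI := fun r => isMarkovKernel_ptbcInReplica (μ := μ) (l := l) hp hm0 hMtop hmp hpM r
  haveI : ∀ r, IsProbabilityMeasure (piGibbsLaw μ (p r)) := fun r =>
    isProbabilityMeasure_piGibbsLaw (μ := μ) hm0 hMtop (hmp r) (hpM r)
  haveI : ∀ r, IsProbabilityMeasure ((Measure.pi μ).bind ⇑(ηr r)) := fun r =>
    ⟨by rw [Measure.bind_apply MeasurableSet.univ (Kernel.aemeasurable _)]; simp⟩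
  exact replicaCycle_convergesTo_pi (K := fun r => ηr r ∘ₖ ptbcInReplica μ p l r)
    (ν := fun r => (Measure.pi μ).bind ⇑(ηr r)) (π := fun r => piGibbsLaw μ (p r))
    (fun r x => minorised_comp_left (ptbcInReplica_minorised hp hm0 hMtop hmp hpM hl r) (ηr r) x)
    (fun r => (hηr r).comp (ptbcInReplica_invariant hp hm0 hMtop hmp hpM r)) hL η hη μ₀ t A

end PTBC

end Summit.Ventures.LatticeQCDFlow.Exactness
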